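/-
Origin: expansion seat `planner-pub-hodgecm-mc-theta-3-g12-0`, handover (T) 2026-08-20T04:33Z md5 2b89c8d4a3a31ec353db1fc5d0027de9 (423 l.; NEW additive leaf over installed (F2) `HodgeCM.Model.ArchLineOrient`; TOTAL row-5 line datum `archLineDatumTotal` (no positivity hypothesis; vacuum filler off the slot sign) + read-backs; 10 defs + 24 theorems; rc 0 / 0 warn / trio 9/9; NAME LIST: HodgeCM.Model.ArchSideTerm.lineT_hctr · HodgeCM.Model.ArchSideTerm.archLineDatumTotal_Φinf_of_goodCtx · HodgeCM.Model.ArchSideTerm.archLineDatumTotal_Φinf_of_goodCtx_of_not_orient) (`HOME/mc/pub-hodgecm-mc-theta-3-g12/lean/stage41/HodgeCM/Model/ArchLineDatumTotal.lean`, md5 2b89c8d4a3a3, 423 lines);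
landed by the gen-15 packager (p-g15) in gate run 41 as `HodgeCM/Model/ArchLineDatumTotal.lean` (verbatim).
-/
/-
Origin: speedrun cell pub-hodgecm, MODEL-CONSTRUCTION sub-cell, lineage mc-theta-3 (BINDER-OWNERS row 5, the `𝔄` slot),
seat planner-pub-hodgecm-mc-theta-3-g12-0 (gen 12), 2026-08-20.  Target in PKG: `HodgeCM/Model/ArchLineDatumTotal.lean`
(NEW additive leaf over `HodgeCM.Model.ArchLineOrient` (F2), hence over (F1) `ArchLineDatumOf`).  KERNEL only: 0 records /
named facts / proof holes.
-/
import Summits.HodgeConjecture.HodgeCM.Model.ArchLineOrient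

/-!
# The archimedean line datum, TOTAL in the context: `𝔄 V c` at EVERY `c`

(F1) `archLineDatumOf` inhabits E's row-5 interface `ArchLineDatum V S hGR hGR₀ hGR₁ hGR₂ hGR₃ η μ` under four CONDITIONS
`hposₖ : 0 < cmXW … (lineVec dₖ) … v₁ 0` (line `k` is model-positive at `v₁`, so that carch-1's slot bijections `eR ≃ Unit`,
`eS ≃ Empty` exist and the degree-one vector `linePhi` can be written).  E's binder is `𝔄 : ∀ V c, ArchLineDatum V c.D …` —
TOTAL in `c`.  This leaf removes the four conditions by a per-line case split that is HONEST in both branches: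

* line model-positive at `v₁` (`hpos`): the degree-one datum of (F1) — `linePhi`, `lineX₀`, eigenvalue `lineC = χ · ι_{w(v₁)}`;
* line model-negative at `v₁` (`¬ hpos`): the VACUUM datum — `vacPhi := follandFock 𝔢 1`, a rational point `vacX₀` where it does
  not vanish, eigenvalue `vacC := χ = lineCenterChar` (the vacuum equation `lineCenterChar_vacuum` of (F1) IS its centre equation).

`linePhiT / lineX₀T / lineCT` are the `dite`/`ite` of the two, (D5-ctr) is PROVED for them (`lineT_hctr`, via (F1)'s transport
`cmPairRep_cmCenter_inf_one_testFun`), and `archLineDatumTotal V S hGR … η μ (hμ₀ … hμ₃) : ArchLineDatum V S …` is the datum with NO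
positivity condition, the four (J-μ) identities `hμₖ` now typed over the total eigenvalue `lineCT`.  Read-back: under the four `hposₖ`
the datum's fields ARE (F1)'s (`archLineDatumTotal_Φinf_of_pos` …, by `dif_pos`), in particular at every good context of a recipe
bit satisfying (F2)'s orientation Prop (`archLineDatumTotal_Φinf_of_goodCtx`); at a good context violating it every test vector is
the vacuum (`archLineDatumTotal_Φinf_of_goodCtx_of_not_orient`).  `ArchLineDatum` has no `K`-type field, so both branches are
legitimate inhabitants; which branch carch-1's `C`/`hk`/`hpd` binders then speak about is decided by the recipe bit, not here.
Nothing is cited and nothing is minted: kernel constructions over (F1)/(F2) and binder-2's compact-letters engine.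
-/

set_option autoImplicit false

noncomputable section

open NumberField NumberField.InfinitePlace NumberField.mixedEmbedding IsDedekindDomain
open scoped Matrix Kronecker Classical TensorProduct ComplexConjugate SchwartzMap
open MvPolynomial
open Literature.NumberTheory.Automorphic Literature.NumberTheory.Automorphic.UnitaryGroup Literature.NumberTheory.Weil1964
open Literature.RepresentationTheory.KonnoKonno2007 Literature.RepresentationTheory.KonnoKonno2007.RealDualPair
open Literature.NumberTheory.GelbartRogawski1991 Literature.NumberTheory.GelbartRogawski1991.UnitaryDualPair
open Literature.Analysis.SegalBargmann
open HodgeCM.Adelic HodgeCM.PerL34 HodgeCM.Model.HypCensus HodgeCM.Model.SupplyInstance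

namespace HodgeCM.Model.ArchSideTerm

/-! ## § 1 The vacuum datum of one line (no positivity condition) -/

section OneLineVac

variable {L : CMField} {ι₁ : L →+* ℂ} (V : HermSpace3 L ι₁)
variable (d : (L : Type)) (hd : IsCMField.complexConj L d = d) (hd0 : d ≠ 0)
  (hGRd : (cmSplittingDatum (L : Type) (e₁) (frameD V) (frameD_real V) (frameD_ne V) (lineVec (L : Type) d) (fun _ => hd)
    (fun _ => hd0)).CompatibleSplitting)

/-- **the vacuum of the pair `(V, ⟨d⟩)`**: the Folland–Fock vector of the constant polynomial `1` in binder-2's big frame. -/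
def vacPhi : 𝓢(((Fin 3) → mixedSpace (↥(maximalRealSubfield L))), ℂ) :=
  follandFock (cmBigFrame (L : Type) e₁ (frameD V) (frameD_real V) (frameD_ne V) (lineVec (L : Type) d) (fun _ => hd) (fun _ => hd0) ι₁) 1

/-- (Ported verbatim from the HodgeCMPerL package; no docstring in the source.) -/
theorem vacPhi_def : vacPhi V d hd hd0 =
    follandFock (cmBigFrame (L : Type) e₁ (frameD V) (frameD_real V) (frameD_ne V) (lineVec (L : Type) d) (fun _ => hd) (fun _ => hd0) ι₁) 1 :=
  rfl

/-- the Folland–Fock vacuum of any frame is nonzero. [folklore] -/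
theorem follandFock_vacuum_ne_zero {D : Type} [NormedAddCommGroup D] [NormedSpace ℝ D] {σ : Type} [Fintype σ]
    (e : D ≃L[ℝ] (σ → ℝ)) : follandFock e (1 : MvPolynomial σ ℂ) ≠ 0 := fun h => by
  have h1 := schwartzTransport_follandFock e (1 : MvPolynomial σ ℂ)
  rw [h, map_zero] at h1
  exact binvPi_one_ne_zero h1.symm

/-- (Ported verbatim from the HodgeCMPerL package; no docstring in the source.) -/
theorem vacPhi_ne_zero : vacPhi V d hd hd0 ≠ 0 :=
  follandFock_vacuum_ne_zero _

/-- a rational point where the vacuum does not vanish (chosen). -/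
def vacX₀ : Fin 3 → ↥(maximalRealSubfield L) :=
  (exists_apply_archEmb_ne_zero (↥(maximalRealSubfield L)) (Fin 3) (vacPhi V d hd hd0) (vacPhi_ne_zero V d hd hd0)).choose

/-- (Ported verbatim from the HodgeCMPerL package; no docstring in the source.) -/
theorem vacPhi_archEmb_vacX₀_ne_zero :
    vacPhi V d hd hd0 (archEmb (↥(maximalRealSubfield L)) (Fin 3) (vacX₀ V d hd hd0)) ≠ 0 :=
  (exists_apply_archEmb_ne_zero (↥(maximalRealSubfield L)) (Fin 3) (vacPhi V d hd hd0) (vacPhi_ne_zero V d hd hd0)).choose_spec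

/-- **the centre eigenvalue of the vacuum**: the vacuum character `χ = lineCenterChar` itself. -/
def vacC (t : ↥(Literature.NumberTheory.Automorphic.relNormOneInfUnits (↥(maximalRealSubfield L)) L)) : ℂ :=
  ((lineCenterChar V d hd hd0 hGRd t : Circle) : ℂ)

/-- (Ported verbatim from the HodgeCMPerL package; no docstring in the source.) -/
theorem vacC_def (t : ↥(Literature.NumberTheory.Automorphic.relNormOneInfUnits (↥(maximalRealSubfield L)) L)) : vacC V d hd hd0 hGRd t = ((lineCenterChar V d hd hd0 hGRd t : Circle) : ℂ) := rfl

/-- the archimedean centre acts on the vacuum by `χ(t)` ((F1) `lineCenterChar_vacuum`). -/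
theorem cmArchWeilRep_center_vacPhi (t : ↥(Literature.NumberTheory.Automorphic.relNormOneInfUnits (↥(maximalRealSubfield L)) L)) :
    cmArchWeilRep (L : Type) e₁ (frameD V) (frameD_real V) (frameD_ne V) (lineVec (L : Type) d) (fun _ => hd) (fun _ => hd0) hGRd
        (cmArchCenter (L : Type) 3 (Matrix.diagonal (frameD V)) t, 1) (vacPhi V d hd hd0) =
      vacC V d hd hd0 hGRd t • vacPhi V d hd hd0 :=
  lineCenterChar_vacuum V d hd hd0 hGRd t

/-- **(D5-ctr) of the vacuum, PROVED**: `ω((t,1)·1_V, 1) φ_N(vacuum) = χ(t) • φ_N(vacuum)` at every base point and level. -/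
theorem vac_hctr (x₀ : Fin 3 → ↥(maximalRealSubfield L)) (Nl : ℕ) (t : ↥(Literature.NumberTheory.Automorphic.relNormOneInfUnits (↥(maximalRealSubfield L)) L)) :
    cmPairRep (L : Type) e₁ (frameD V) (frameD_real V) (frameD_ne V) (lineVec (L : Type) d) (fun _ => hd) (fun _ => hd0) hGRd
        (CMCenter (L : Type) (frameD V)
          ((cmAdelicOneEquivRelNormOne (L : Type)).symm (Literature.NumberTheory.Automorphic.relNormOneInfToIdeles (↥(maximalRealSubfield L)) L t)), 1)
        (testFun (↥(maximalRealSubfield L)) (Fin 3) (vacPhi V d hd hd0) x₀ Nl) =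
      vacC V d hd hd0 hGRd t • testFun (↥(maximalRealSubfield L)) (Fin 3) (vacPhi V d hd hd0) x₀ Nl := by
  rw [cmPairRep_cmCenter_inf_one_testFun, cmArchWeilRep_center_vacPhi, testFun_smul]

end OneLineVac

/-! ## § 2 The TOTAL datum of one line: degree-one vector if model-positive at `v₁`, vacuum otherwise -/

section OneLineTotal

variable {L : CMField} {ι₁ : L →+* ℂ} (V : HermSpace3 L ι₁)
variable (d : (L : Type)) (hd : IsCMField.complexConj L d = d) (hd0 : d ≠ 0)
  (hGRd : (cmSplittingDatum (L : Type) (e₁) (frameD V) (frameD_real V) (frameD_ne V) (lineVec (L : Type) d) (fun _ => hd)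
    (fun _ => hd0)).CompatibleSplitting)

/-- **`Φ_∞` of the line, total.** -/
def linePhiT : 𝓢(((Fin 3) → mixedSpace (↥(maximalRealSubfield L))), ℂ) :=
  if h : 0 < cmXW (L : Type) (frameD V) (lineVec (L : Type) d) (fun _ => hd) ι₁ (HypCensus.cmPlace (L : Type) ι₁) 0 then
    linePhi V d hd hd0 h
  else vacPhi V d hd hd0

/-- **`x₀` of the line, total.** -/
def lineX₀T : Fin 3 → ↥(maximalRealSubfield L) :=
  if h : 0 < cmXW (L : Type) (frameD V) (lineVec (L : Type) d) (fun _ => hd) ι₁ (HypCensus.cmPlace (L : Type) ι₁) 0 then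
    lineX₀ V d hd hd0 h
  else vacX₀ V d hd hd0

/-- **the centre eigenvalue of the line, total.** -/
def lineCT (t : ↥(Literature.NumberTheory.Automorphic.relNormOneInfUnits (↥(maximalRealSubfield L)) L)) : ℂ :=
  if 0 < cmXW (L : Type) (frameD V) (lineVec (L : Type) d) (fun _ => hd) ι₁ (HypCensus.cmPlace (L : Type) ι₁) 0 then
    lineC V d hd hd0 hGRd t
  else vacC V d hd hd0 hGRd t

variable {V d hd hd0}

/-- (Ported verbatim from the HodgeCMPerL package; no docstring in the source.) -/
theorem linePhiT_of_pos (h : 0 < cmXW (L : Type) (frameD V) (lineVec (L : Type) d) (fun _ => hd) ι₁ (HypCensus.cmPlace (L : Type) ι₁) 0) :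
    linePhiT V d hd hd0 = linePhi V d hd hd0 h :=
  dif_pos h

/-- (Ported verbatim from the HodgeCMPerL package; no docstring in the source.) -/
theorem linePhiT_of_not_pos (h : ¬ 0 < cmXW (L : Type) (frameD V) (lineVec (L : Type) d) (fun _ => hd) ι₁ (HypCensus.cmPlace (L : Type) ι₁) 0) :
    linePhiT V d hd hd0 = vacPhi V d hd hd0 :=
  dif_neg h

/-- (Ported verbatim from the HodgeCMPerL package; no docstring in the source.) -/
theorem lineX₀T_of_pos (h : 0 < cmXW (L : Type) (frameD V) (lineVec (L : Type) d) (fun _ => hd) ι₁ (HypCensus.cmPlace (L : Type) ι₁) 0) :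
    lineX₀T V d hd hd0 = lineX₀ V d hd hd0 h :=
  dif_pos h

/-- (Ported verbatim from the HodgeCMPerL package; no docstring in the source.) -/
theorem lineX₀T_of_not_pos (h : ¬ 0 < cmXW (L : Type) (frameD V) (lineVec (L : Type) d) (fun _ => hd) ι₁ (HypCensus.cmPlace (L : Type) ι₁) 0) :
    lineX₀T V d hd hd0 = vacX₀ V d hd hd0 :=
  dif_neg h

variable {hGRd}

/-- (Ported verbatim from the HodgeCMPerL package; no docstring in the source.) -/
theorem lineCT_of_pos (h : 0 < cmXW (L : Type) (frameD V) (lineVec (L : Type) d) (fun _ => hd) ι₁ (HypCensus.cmPlace (L : Type) ι₁) 0)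
    (t : ↥(Literature.NumberTheory.Automorphic.relNormOneInfUnits (↥(maximalRealSubfield L)) L)) : lineCT V d hd hd0 hGRd t = lineC V d hd hd0 hGRd t :=
  if_pos h

/-- (Ported verbatim from the HodgeCMPerL package; no docstring in the source.) -/
theorem lineCT_of_not_pos (h : ¬ 0 < cmXW (L : Type) (frameD V) (lineVec (L : Type) d) (fun _ => hd) ι₁ (HypCensus.cmPlace (L : Type) ι₁) 0)
    (t : ↥(Literature.NumberTheory.Automorphic.relNormOneInfUnits (↥(maximalRealSubfield L)) L)) : lineCT V d hd hd0 hGRd t = vacC V d hd hd0 hGRd t :=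
  if_neg h

variable (V d hd hd0 hGRd)

/-- `Φ_∞(x₀) ≠ 0`, total. -/
theorem linePhiT_archEmb_lineX₀T_ne_zero :
    linePhiT V d hd hd0 (archEmb (↥(maximalRealSubfield L)) (Fin 3) (lineX₀T V d hd hd0)) ≠ 0 := by
  by_cases h : 0 < cmXW (L : Type) (frameD V) (lineVec (L : Type) d) (fun _ => hd) ι₁ (HypCensus.cmPlace (L : Type) ι₁) 0
  · rw [linePhiT_of_pos h, lineX₀T_of_pos h]
    exact linePhi_archEmb_lineX₀_ne_zero V d hd hd0 h
  · rw [linePhiT_of_not_pos h, lineX₀T_of_not_pos h]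
    exact vacPhi_archEmb_vacX₀_ne_zero V d hd hd0

/-- the archimedean centre acts on the total `Φ_∞` by the total eigenvalue. -/
theorem cmArchWeilRep_center_linePhiT (t : ↥(Literature.NumberTheory.Automorphic.relNormOneInfUnits (↥(maximalRealSubfield L)) L)) :
    cmArchWeilRep (L : Type) e₁ (frameD V) (frameD_real V) (frameD_ne V) (lineVec (L : Type) d) (fun _ => hd) (fun _ => hd0) hGRd
        (cmArchCenter (L : Type) 3 (Matrix.diagonal (frameD V)) t, 1) (linePhiT V d hd hd0) =
      lineCT V d hd hd0 hGRd t • linePhiT V d hd hd0 := by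
  by_cases h : 0 < cmXW (L : Type) (frameD V) (lineVec (L : Type) d) (fun _ => hd) ι₁ (HypCensus.cmPlace (L : Type) ι₁) 0
  · rw [linePhiT_of_pos h, lineCT_of_pos h]
    exact cmArchWeilRep_center_linePhi V d hd hd0 hGRd h t
  · rw [linePhiT_of_not_pos h, lineCT_of_not_pos h]
    exact cmArchWeilRep_center_vacPhi V d hd hd0 hGRd t

/-- **(D5-ctr) OF THE LINE, PROVED, total**: `ω((t,1)·1_V, 1) φ_N(Φ_∞) = c(t) • φ_N(Φ_∞)` at every base point and level. -/
theorem lineT_hctr (x₀ : Fin 3 → ↥(maximalRealSubfield L)) (Nl : ℕ) (t : ↥(Literature.NumberTheory.Automorphic.relNormOneInfUnits (↥(maximalRealSubfield L)) L)) :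
    cmPairRep (L : Type) e₁ (frameD V) (frameD_real V) (frameD_ne V) (lineVec (L : Type) d) (fun _ => hd) (fun _ => hd0) hGRd
        (CMCenter (L : Type) (frameD V)
          ((cmAdelicOneEquivRelNormOne (L : Type)).symm (Literature.NumberTheory.Automorphic.relNormOneInfToIdeles (↥(maximalRealSubfield L)) L t)), 1)
        (testFun (↥(maximalRealSubfield L)) (Fin 3) (linePhiT V d hd hd0) x₀ Nl) =
      lineCT V d hd hd0 hGRd t • testFun (↥(maximalRealSubfield L)) (Fin 3) (linePhiT V d hd hd0) x₀ Nl := by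
  rw [cmPairRep_cmCenter_inf_one_testFun, cmArchWeilRep_center_linePhiT, testFun_smul]

end OneLineTotal

/-! ## § 3 The total datum of the S pin -/

section Datum

variable {L : CMField} {ι₁ : L →+* ℂ} (V : HermSpace3 L ι₁) (S : StubTree.SeesawDatum L)
variable
  (hGR : (cmSplittingDatum (L : Type) finProdFinEquiv (frameD V) (frameD_real V) (frameD_ne V) (dW S) (dW_real S) (dW_ne S)).CompatibleSplitting)
  (hGR₀ : (cmSplittingDatum (L : Type) (e₁) (frameD V) (frameD_real V) (frameD_ne V) (lineVec (L : Type) (dW S 0))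
    (fun _ => dW_real S 0) (fun _ => dW_ne S 0)).CompatibleSplitting)
  (hGR₁ : (cmSplittingDatum (L : Type) (e₁) (frameD V) (frameD_real V) (frameD_ne V) (lineVec (L : Type) (dW S 1))
    (fun _ => dW_real S 1) (fun _ => dW_ne S 1)).CompatibleSplitting)
  (hGR₂ : (cmSplittingDatum (L : Type) (e₁) (frameD V) (frameD_real V) (frameD_ne V) (lineVec (L : Type) (dW' S 0))
    (fun _ => dW'_real S 0) (fun _ => dW'_ne S 0)).CompatibleSplitting)
  (hGR₃ : (cmSplittingDatum (L : Type) (e₁) (frameD V) (frameD_real V) (frameD_ne V) (lineVec (L : Type) (dW' S 1))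
    (fun _ => dW'_real S 1) (fun _ => dW'_ne S 1)).CompatibleSplitting)
  (η : CMAdelic (L : Type) (frameD V) × CMAdelic (L : Type) (dW S) →* ℂˣ)
  (μ : Fin 4 → (InfinitePlace (L : Type) → ℤ))

/-- the four total centre eigenvalues. -/
def lineCTVec : Fin 4 → (↥(Literature.NumberTheory.Automorphic.relNormOneInfUnits (↥(maximalRealSubfield L)) L) → ℂ) :=
  ![lineCT V (dW S 0) (dW_real S 0) (dW_ne S 0) hGR₀, lineCT V (dW S 1) (dW_real S 1) (dW_ne S 1) hGR₁,
    lineCT V (dW' S 0) (dW'_real S 0) (dW'_ne S 0) hGR₂, lineCT V (dW' S 1) (dW'_real S 1) (dW'_ne S 1) hGR₃]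

/-- the four total archimedean test functions. -/
def linePhiTVec : Fin 4 → 𝓢(((Fin 3) → mixedSpace (↥(maximalRealSubfield L))), ℂ) :=
  ![linePhiT V (dW S 0) (dW_real S 0) (dW_ne S 0), linePhiT V (dW S 1) (dW_real S 1) (dW_ne S 1),
    linePhiT V (dW' S 0) (dW'_real S 0) (dW'_ne S 0), linePhiT V (dW' S 1) (dW'_real S 1) (dW'_ne S 1)]

/-- the four total rational base points. -/
def lineX₀TVec : Fin 4 → (Fin 3 → ↥(maximalRealSubfield L)) :=
  ![lineX₀T V (dW S 0) (dW_real S 0) (dW_ne S 0), lineX₀T V (dW S 1) (dW_real S 1) (dW_ne S 1),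
    lineX₀T V (dW' S 0) (dW'_real S 0) (dW'_ne S 0), lineX₀T V (dW' S 1) (dW'_real S 1) (dW'_ne S 1)]

set_option maxHeartbeats 800000 in
/-- **THE ARCHIMEDEAN LINE DATUM OF THE S PIN, TOTAL.**  Inputs: the pin (`V`, `S`, the GR splittings, `η`, the weights `μ`) and the
four NAMED (J-μ) weight identities about the total eigenvalues `lineCT`; NO positivity condition.  `Φinf`, `x₀`, `hx₀`, `c`,
(D5-ctr)₀…₃ are constructed resp. PROVED above, honestly in both branches of each line. -/
def archLineDatumTotal
    (hμ₀ : ∀ t : ↥(Literature.NumberTheory.Automorphic.relNormOneInfUnits (↥(maximalRealSubfield L)) L),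
      ((eta₀ V S η (1, (cmAdelicOneEquivRelNormOne (L : Type)).symm (Literature.NumberTheory.Automorphic.relNormOneInfToIdeles (↥(maximalRealSubfield L)) L t)) *
              cmLineChar₀ (L : Type) finProdFinEquiv e₁ (frameD V) (frameD_real V) (frameD_ne V) (dW S) (dW_real S) (dW_ne S)
                hGR hGR₀ hGR₁
                (1, CMCenter (L : Type) (lineVec (L : Type) (dW S 0))
                  ((cmAdelicOneEquivRelNormOne (L : Type)).symm (Literature.NumberTheory.Automorphic.relNormOneInfToIdeles (↥(maximalRealSubfield L)) L t))) :
            ℂˣ) : ℂ) * lineCT V (dW S 0) (dW_real S 0) (dW_ne S 0) hGR₀ t =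
        Literature.NumberTheory.Automorphic.archWeight (L : Type) (μ 0) t)
    (hμ₁ : ∀ t : ↥(Literature.NumberTheory.Automorphic.relNormOneInfUnits (↥(maximalRealSubfield L)) L),
      ((eta₁ V S η (1, (cmAdelicOneEquivRelNormOne (L : Type)).symm (Literature.NumberTheory.Automorphic.relNormOneInfToIdeles (↥(maximalRealSubfield L)) L t)) *
              cmLineChar₁ (L : Type) finProdFinEquiv e₁ (frameD V) (frameD_real V) (frameD_ne V) (dW S) (dW_real S) (dW_ne S)
                hGR hGR₀ hGR₁
                (1, CMCenter (L : Type) (lineVec (L : Type) (dW S 1))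
                  ((cmAdelicOneEquivRelNormOne (L : Type)).symm (Literature.NumberTheory.Automorphic.relNormOneInfToIdeles (↥(maximalRealSubfield L)) L t))) :
            ℂˣ) : ℂ) * lineCT V (dW S 1) (dW_real S 1) (dW_ne S 1) hGR₁ t =
        Literature.NumberTheory.Automorphic.archWeight (L : Type) (μ 1) t)
    (hμ₂ : ∀ t : ↥(Literature.NumberTheory.Automorphic.relNormOneInfUnits (↥(maximalRealSubfield L)) L),
      ((eta₂ V S η (1, (cmAdelicOneEquivRelNormOne (L : Type)).symm (Literature.NumberTheory.Automorphic.relNormOneInfToIdeles (↥(maximalRealSubfield L)) L t)) *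
              cmConjLineChar₀ (L : Type) finProdFinEquiv e₁ (frameD V) (frameD_real V) (frameD_ne V) (dW S) (dW_real S) (dW_ne S)
                (dW' S) (dW'_real S) (dW'_ne S) S.isoGL (isoGL_hg₀ S) hGR hGR₂ hGR₃
                (1, CMCenter (L : Type) (lineVec (L : Type) (dW' S 0))
                  ((cmAdelicOneEquivRelNormOne (L : Type)).symm (Literature.NumberTheory.Automorphic.relNormOneInfToIdeles (↥(maximalRealSubfield L)) L t))) :
            ℂˣ) : ℂ) * lineCT V (dW' S 0) (dW'_real S 0) (dW'_ne S 0) hGR₂ t =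
        Literature.NumberTheory.Automorphic.archWeight (L : Type) (μ 2) t)
    (hμ₃ : ∀ t : ↥(Literature.NumberTheory.Automorphic.relNormOneInfUnits (↥(maximalRealSubfield L)) L),
      ((eta₃ V S η (1, (cmAdelicOneEquivRelNormOne (L : Type)).symm (Literature.NumberTheory.Automorphic.relNormOneInfToIdeles (↥(maximalRealSubfield L)) L t)) *
              cmConjLineChar₁ (L : Type) finProdFinEquiv e₁ (frameD V) (frameD_real V) (frameD_ne V) (dW S) (dW_real S) (dW_ne S)
                (dW' S) (dW'_real S) (dW'_ne S) S.isoGL (isoGL_hg₀ S) hGR hGR₂ hGR₃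
                (1, CMCenter (L : Type) (lineVec (L : Type) (dW' S 1))
                  ((cmAdelicOneEquivRelNormOne (L : Type)).symm (Literature.NumberTheory.Automorphic.relNormOneInfToIdeles (↥(maximalRealSubfield L)) L t))) :
            ℂˣ) : ℂ) * lineCT V (dW' S 1) (dW'_real S 1) (dW'_ne S 1) hGR₃ t =
        Literature.NumberTheory.Automorphic.archWeight (L : Type) (μ 3) t) :
    ArchLineDatum V S hGR hGR₀ hGR₁ hGR₂ hGR₃ η μ where
  Φinf := linePhiTVec V S
  x₀ := lineX₀TVec V S
  hx₀ k := by
    fin_cases k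
    · exact linePhiT_archEmb_lineX₀T_ne_zero V (dW S 0) (dW_real S 0) (dW_ne S 0)
    · exact linePhiT_archEmb_lineX₀T_ne_zero V (dW S 1) (dW_real S 1) (dW_ne S 1)
    · exact linePhiT_archEmb_lineX₀T_ne_zero V (dW' S 0) (dW'_real S 0) (dW'_ne S 0)
    · exact linePhiT_archEmb_lineX₀T_ne_zero V (dW' S 1) (dW'_real S 1) (dW'_ne S 1)
  c := lineCTVec V S hGR₀ hGR₁ hGR₂ hGR₃
  hctr₀ N t := lineT_hctr V (dW S 0) (dW_real S 0) (dW_ne S 0) hGR₀ _ N t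
  hctr₁ N t := lineT_hctr V (dW S 1) (dW_real S 1) (dW_ne S 1) hGR₁ _ N t
  hctr₂ N t := lineT_hctr V (dW' S 0) (dW'_real S 0) (dW'_ne S 0) hGR₂ _ N t
  hctr₃ N t := lineT_hctr V (dW' S 1) (dW'_real S 1) (dW'_ne S 1) hGR₃ _ N t
  hμ₀ := hμ₀
  hμ₁ := hμ₁
  hμ₂ := hμ₂
  hμ₃ := hμ₃

variable {V S hGR hGR₀ hGR₁ hGR₂ hGR₃ η μ}

/-! ### read-off lemmas -/

section ReadOff

variable
  {hμ₀ : ∀ t : ↥(Literature.NumberTheory.Automorphic.relNormOneInfUnits (↥(maximalRealSubfield L)) L),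
      ((eta₀ V S η (1, (cmAdelicOneEquivRelNormOne (L : Type)).symm (Literature.NumberTheory.Automorphic.relNormOneInfToIdeles (↥(maximalRealSubfield L)) L t)) *
              cmLineChar₀ (L : Type) finProdFinEquiv e₁ (frameD V) (frameD_real V) (frameD_ne V) (dW S) (dW_real S) (dW_ne S)
                hGR hGR₀ hGR₁
                (1, CMCenter (L : Type) (lineVec (L : Type) (dW S 0))
                  ((cmAdelicOneEquivRelNormOne (L : Type)).symm (Literature.NumberTheory.Automorphic.relNormOneInfToIdeles (↥(maximalRealSubfield L)) L t))) :
            ℂˣ) : ℂ) * lineCT V (dW S 0) (dW_real S 0) (dW_ne S 0) hGR₀ t =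
        Literature.NumberTheory.Automorphic.archWeight (L : Type) (μ 0) t}
  {hμ₁ : ∀ t : ↥(Literature.NumberTheory.Automorphic.relNormOneInfUnits (↥(maximalRealSubfield L)) L),
      ((eta₁ V S η (1, (cmAdelicOneEquivRelNormOne (L : Type)).symm (Literature.NumberTheory.Automorphic.relNormOneInfToIdeles (↥(maximalRealSubfield L)) L t)) *
              cmLineChar₁ (L : Type) finProdFinEquiv e₁ (frameD V) (frameD_real V) (frameD_ne V) (dW S) (dW_real S) (dW_ne S)
                hGR hGR₀ hGR₁
                (1, CMCenter (L : Type) (lineVec (L : Type) (dW S 1))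
                  ((cmAdelicOneEquivRelNormOne (L : Type)).symm (Literature.NumberTheory.Automorphic.relNormOneInfToIdeles (↥(maximalRealSubfield L)) L t))) :
            ℂˣ) : ℂ) * lineCT V (dW S 1) (dW_real S 1) (dW_ne S 1) hGR₁ t =
        Literature.NumberTheory.Automorphic.archWeight (L : Type) (μ 1) t}
  {hμ₂ : ∀ t : ↥(Literature.NumberTheory.Automorphic.relNormOneInfUnits (↥(maximalRealSubfield L)) L),
      ((eta₂ V S η (1, (cmAdelicOneEquivRelNormOne (L : Type)).symm (Literature.NumberTheory.Automorphic.relNormOneInfToIdeles (↥(maximalRealSubfield L)) L t)) *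
              cmConjLineChar₀ (L : Type) finProdFinEquiv e₁ (frameD V) (frameD_real V) (frameD_ne V) (dW S) (dW_real S) (dW_ne S)
                (dW' S) (dW'_real S) (dW'_ne S) S.isoGL (isoGL_hg₀ S) hGR hGR₂ hGR₃
                (1, CMCenter (L : Type) (lineVec (L : Type) (dW' S 0))
                  ((cmAdelicOneEquivRelNormOne (L : Type)).symm (Literature.NumberTheory.Automorphic.relNormOneInfToIdeles (↥(maximalRealSubfield L)) L t))) :
            ℂˣ) : ℂ) * lineCT V (dW' S 0) (dW'_real S 0) (dW'_ne S 0) hGR₂ t =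
        Literature.NumberTheory.Automorphic.archWeight (L : Type) (μ 2) t}
  {hμ₃ : ∀ t : ↥(Literature.NumberTheory.Automorphic.relNormOneInfUnits (↥(maximalRealSubfield L)) L),
      ((eta₃ V S η (1, (cmAdelicOneEquivRelNormOne (L : Type)).symm (Literature.NumberTheory.Automorphic.relNormOneInfToIdeles (↥(maximalRealSubfield L)) L t)) *
              cmConjLineChar₁ (L : Type) finProdFinEquiv e₁ (frameD V) (frameD_real V) (frameD_ne V) (dW S) (dW_real S) (dW_ne S)
                (dW' S) (dW'_real S) (dW'_ne S) S.isoGL (isoGL_hg₀ S) hGR hGR₂ hGR₃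
                (1, CMCenter (L : Type) (lineVec (L : Type) (dW' S 1))
                  ((cmAdelicOneEquivRelNormOne (L : Type)).symm (Literature.NumberTheory.Automorphic.relNormOneInfToIdeles (↥(maximalRealSubfield L)) L t))) :
            ℂˣ) : ℂ) * lineCT V (dW' S 1) (dW'_real S 1) (dW'_ne S 1) hGR₃ t =
        Literature.NumberTheory.Automorphic.archWeight (L : Type) (μ 3) t}

/-- (Ported verbatim from the HodgeCMPerL package; no docstring in the source.) -/
theorem archLineDatumTotal_Φinf :
    (archLineDatumTotal V S hGR hGR₀ hGR₁ hGR₂ hGR₃ η μ hμ₀ hμ₁ hμ₂ hμ₃).Φinf = linePhiTVec V S := rfl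

/-- (Ported verbatim from the HodgeCMPerL package; no docstring in the source.) -/
theorem archLineDatumTotal_x₀ :
    (archLineDatumTotal V S hGR hGR₀ hGR₁ hGR₂ hGR₃ η μ hμ₀ hμ₁ hμ₂ hμ₃).x₀ = lineX₀TVec V S := rfl

/-- (Ported verbatim from the HodgeCMPerL package; no docstring in the source.) -/
theorem archLineDatumTotal_c :
    (archLineDatumTotal V S hGR hGR₀ hGR₁ hGR₂ hGR₃ η μ hμ₀ hμ₁ hμ₂ hμ₃).c = lineCTVec V S hGR₀ hGR₁ hGR₂ hGR₃ := rfl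

/-- **under the four positivity conditions the total datum's test functions ARE (F1)'s degree-one vectors.** -/
theorem archLineDatumTotal_Φinf_of_pos
    (hpos₀ : 0 < cmXW (L : Type) (frameD V) (lineVec (L : Type) (dW S 0)) (fun _ => dW_real S 0) ι₁ (HypCensus.cmPlace (L : Type) ι₁) 0)
    (hpos₁ : 0 < cmXW (L : Type) (frameD V) (lineVec (L : Type) (dW S 1)) (fun _ => dW_real S 1) ι₁ (HypCensus.cmPlace (L : Type) ι₁) 0)
    (hpos₂ : 0 < cmXW (L : Type) (frameD V) (lineVec (L : Type) (dW' S 0)) (fun _ => dW'_real S 0) ι₁ (HypCensus.cmPlace (L : Type) ι₁) 0)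
    (hpos₃ : 0 < cmXW (L : Type) (frameD V) (lineVec (L : Type) (dW' S 1)) (fun _ => dW'_real S 1) ι₁ (HypCensus.cmPlace (L : Type) ι₁) 0) :
    (archLineDatumTotal V S hGR hGR₀ hGR₁ hGR₂ hGR₃ η μ hμ₀ hμ₁ hμ₂ hμ₃).Φinf = linePhiVec V S hpos₀ hpos₁ hpos₂ hpos₃ := by
  funext k
  fin_cases k
  · exact linePhiT_of_pos hpos₀
  · exact linePhiT_of_pos hpos₁
  · exact linePhiT_of_pos hpos₂
  · exact linePhiT_of_pos hpos₃

/-- (Ported verbatim from the HodgeCMPerL package; no docstring in the source.) -/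
theorem archLineDatumTotal_x₀_of_pos
    (hpos₀ : 0 < cmXW (L : Type) (frameD V) (lineVec (L : Type) (dW S 0)) (fun _ => dW_real S 0) ι₁ (HypCensus.cmPlace (L : Type) ι₁) 0)
    (hpos₁ : 0 < cmXW (L : Type) (frameD V) (lineVec (L : Type) (dW S 1)) (fun _ => dW_real S 1) ι₁ (HypCensus.cmPlace (L : Type) ι₁) 0)
    (hpos₂ : 0 < cmXW (L : Type) (frameD V) (lineVec (L : Type) (dW' S 0)) (fun _ => dW'_real S 0) ι₁ (HypCensus.cmPlace (L : Type) ι₁) 0)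
    (hpos₃ : 0 < cmXW (L : Type) (frameD V) (lineVec (L : Type) (dW' S 1)) (fun _ => dW'_real S 1) ι₁ (HypCensus.cmPlace (L : Type) ι₁) 0) :
    (archLineDatumTotal V S hGR hGR₀ hGR₁ hGR₂ hGR₃ η μ hμ₀ hμ₁ hμ₂ hμ₃).x₀ = lineX₀Vec V S hpos₀ hpos₁ hpos₂ hpos₃ := by
  funext k
  fin_cases k
  · exact lineX₀T_of_pos hpos₀
  · exact lineX₀T_of_pos hpos₁
  · exact lineX₀T_of_pos hpos₂
  · exact lineX₀T_of_pos hpos₃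

/-- (Ported verbatim from the HodgeCMPerL package; no docstring in the source.) -/
theorem archLineDatumTotal_c_of_pos
    (hpos₀ : 0 < cmXW (L : Type) (frameD V) (lineVec (L : Type) (dW S 0)) (fun _ => dW_real S 0) ι₁ (HypCensus.cmPlace (L : Type) ι₁) 0)
    (hpos₁ : 0 < cmXW (L : Type) (frameD V) (lineVec (L : Type) (dW S 1)) (fun _ => dW_real S 1) ι₁ (HypCensus.cmPlace (L : Type) ι₁) 0)
    (hpos₂ : 0 < cmXW (L : Type) (frameD V) (lineVec (L : Type) (dW' S 0)) (fun _ => dW'_real S 0) ι₁ (HypCensus.cmPlace (L : Type) ι₁) 0)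
    (hpos₃ : 0 < cmXW (L : Type) (frameD V) (lineVec (L : Type) (dW' S 1)) (fun _ => dW'_real S 1) ι₁ (HypCensus.cmPlace (L : Type) ι₁) 0) :
    (archLineDatumTotal V S hGR hGR₀ hGR₁ hGR₂ hGR₃ η μ hμ₀ hμ₁ hμ₂ hμ₃).c = lineCVec V S hGR₀ hGR₁ hGR₂ hGR₃ := by
  funext k t
  fin_cases k
  · exact lineCT_of_pos hpos₀ t
  · exact lineCT_of_pos hpos₁ t
  · exact lineCT_of_pos hpos₂ t
  · exact lineCT_of_pos hpos₃ t

end ReadOff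

end Datum

/-! ## § 4 At a good context: the branch is decided by (F2)'s orientation Prop -/


-- port_pkg: scope closed for this part
end HodgeCM.Model.ArchSideTerm
end
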